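import Summits.CriticalPhenomena.CardyFormulaZ2.Theorems.CardySusyWardDiscretisationFamilyExistsLegLocal
import HarnessLib

/-!
# Local geometry at a vertical cut edge — helper for `DiscretisationFamilyExists` (stmt-CriticalPhenomena-9644)

The vertical-edge companion of `…ExistsLegLocal`: cut edge `[u, v]`, `δu = (X₁, Y₀)`,
`δv = (X₁, Y₀ + δ)` (`X₁ = δ(k₁+1)`, `Y₀ = δ y'`), inner cell `(k₁, y')` to the WEST, exit cell
`(k₁+1, y')` to the EAST, for any leg `L ⊆ ℂ` satisfying the trichotomy: every point of `L` in `Ω`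
lies on the mid-line `im = Y₀ + δ/2` with `re ≤ X₁`, or in the open exit cell, or at `re ≤ X₁ - 3δ/2`.
Sector point `z₀ = (X₁ - δ/4, Y₀ + δ/2)`, radius `δ/8`; same six conclusions (`…V`).  Used by the
wide-L leg (`…ExistsLegC2E`).
-/

noncomputable section

open Set Metric Complex
open Literature.Probability.LatticeModels Literature.Probability.Percolation
  Literature.Probability.LatticeModels.Mesh Literature.Probability.LatticeModels.DiscreteDobrushin

namespace Summit.CriticalPhenomena.CardyFormulaZ2.Theorems.DiscretisationFamilyExists

section LocalV

variable {Ω : Set ℂ} {δ X₁ Y₀ : ℝ} {k₁ y' : ℤ} {L : Set ℂ}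

/-- **The sector ball lies in `Ω`** (inside the inner cell west of the cut edge). [folklore] -/
theorem sectorBall_subsetV (hδ : 0 < δ) (hX : X₁ = δ * (k₁ + 1)) (hY : Y₀ = δ * y')
    (hfull : cell δ k₁ y' ⊆ Ω) : ball (⟨X₁ - δ / 4, Y₀ + δ / 2⟩ : ℂ) (δ / 8) ⊆ Ω := by
  intro z hz
  rw [mem_ball, Complex.dist_eq] at hz
  have hre := (abs_re_le_norm (z - ⟨X₁ - δ / 4, Y₀ + δ / 2⟩)).trans_lt hz
  have him := (abs_im_le_norm (z - ⟨X₁ - δ / 4, Y₀ + δ / 2⟩)).trans_lt hz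
  rw [sub_re, abs_lt] at hre
  rw [sub_im, abs_lt] at him
  simp only at hre him
  refine hfull (mem_cell_iff.2 ⟨⟨by linarith, by linarith⟩, by linarith, by linarith⟩)

/-- **The leg meets the sector ball only on the horizontal through `z₀`.** [folklore] -/
theorem inter_sectorBall_subsetV (hδ : 0 < δ) (hX : X₁ = δ * (k₁ + 1)) (hY : Y₀ = δ * y')
    (hfull : cell δ k₁ y' ⊆ Ω) {u v : Site 2} (hueq : meshPoint δ u = ⟨X₁, Y₀⟩)
    (hveq : meshPoint δ v = ⟨X₁, Y₀ + δ⟩)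
    (htri : ∀ z ∈ L, z ∈ Ω → (z.im = Y₀ + δ / 2 ∧ z.re ≤ X₁) ∨ z ∈ cell δ (k₁ + 1) y' ∨ z.re ≤ X₁ - δ * (3 / 2)) :
    L ∩ ball (⟨X₁ - δ / 4, Y₀ + δ / 2⟩ : ℂ) (δ / 8) ⊆
      {z | inner (ℝ) (z - ⟨X₁ - δ / 4, Y₀ + δ / 2⟩) (meshPoint δ v - meshPoint δ u) = 0} := by
  rintro z ⟨hz1, hz2⟩
  have hvu : meshPoint δ v - meshPoint δ u = ⟨0, δ⟩ := by rw [hueq, hveq]; apply Complex.ext <;> simp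
  rw [mem_setOf_eq, hvu, inner_vertical]
  have hzΩ : z ∈ Ω := sectorBall_subsetV hδ hX hY hfull hz2
  rw [mem_ball, Complex.dist_eq] at hz2
  have hre := (abs_re_le_norm (z - ⟨X₁ - δ / 4, Y₀ + δ / 2⟩)).trans_lt hz2
  rw [sub_re, abs_lt] at hre
  simp only at hre
  rcases htri z hz1 hzΩ with ⟨him, -⟩ | h | h
  · rw [sub_im, him]; simp
  · rw [mem_cell_iff] at h; push_cast at h; exfalso; linarith [h.1.1]
  · exfalso; linarith

/-- **Access from `u`** (the lower end): `q = z₀ - (0, δ/16)` is joined to `δu` inside `Ω \ L`.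
[folklore] -/
theorem access_u_localV (hδ : 0 < δ) (hX : X₁ = δ * (k₁ + 1)) (hY : Y₀ = δ * y')
    (hfull : cell δ k₁ y' ⊆ Ω) {u v : Site 2} (hueq : meshPoint δ u = ⟨X₁, Y₀⟩)
    (hveq : meshPoint δ v = ⟨X₁, Y₀ + δ⟩) (huΩ : meshPoint δ u ∈ Ω)
    (htri : ∀ z ∈ L, z ∈ Ω → (z.im = Y₀ + δ / 2 ∧ z.re ≤ X₁) ∨ z ∈ cell δ (k₁ + 1) y' ∨ z.re ≤ X₁ - δ * (3 / 2)) :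
    ∃ q ∈ ball (⟨X₁ - δ / 4, Y₀ + δ / 2⟩ : ℂ) (δ / 8),
      0 < inner (ℝ) (q - ⟨X₁ - δ / 4, Y₀ + δ / 2⟩) (meshPoint δ u - meshPoint δ v) ∧
      segment ℝ (meshPoint δ u) q ⊆ Ω \ L := by
  have huv : meshPoint δ u - meshPoint δ v = ⟨0, -δ⟩ := by rw [hueq, hveq]; apply Complex.ext <;> simp
  refine ⟨⟨X₁ - δ / 4, Y₀ + δ / 2 - δ / 16⟩, ?_, ?_, ?_⟩
  · rw [mem_ball, Complex.dist_eq]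
    rw [show (⟨X₁ - δ / 4, Y₀ + δ / 2 - δ / 16⟩ : ℂ) - ⟨X₁ - δ / 4, Y₀ + δ / 2⟩ = (-(δ / 16) : ℝ) * I by
      apply Complex.ext <;> simp]
    rw [norm_mul, Complex.norm_I, mul_one, Complex.norm_real, Real.norm_eq_abs, abs_of_neg (by linarith)]
    linarith
  · rw [huv, inner_vertical, sub_im]
    simp only
    nlinarith [sq_pos_of_pos hδ]
  · intro z hz
    rw [segment_eq_image'] at hz
    obtain ⟨θ, ⟨h0, h1⟩, rfl⟩ := hz
    rw [hueq]
    have hre : ((⟨X₁, Y₀⟩ : ℂ) + θ • ((⟨X₁ - δ / 4, Y₀ + δ / 2 - δ / 16⟩ : ℂ) - ⟨X₁, Y₀⟩)).re =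
        X₁ - θ * (δ / 4) := by rw [re_param]; simp only; ring
    have him : ((⟨X₁, Y₀⟩ : ℂ) + θ • ((⟨X₁ - δ / 4, Y₀ + δ / 2 - δ / 16⟩ : ℂ) - ⟨X₁, Y₀⟩)).im =
        Y₀ + θ * (δ * (7 / 16)) := by rw [im_param]; simp only; ring
    have hθδ0 : 0 ≤ θ * δ := mul_nonneg h0 hδ.le
    have hθδ1 : θ * δ ≤ δ := mul_le_of_le_one_left hδ.le h1
    have hwΩ : (⟨X₁, Y₀⟩ : ℂ) + θ • ((⟨X₁ - δ / 4, Y₀ + δ / 2 - δ / 16⟩ : ℂ) - ⟨X₁, Y₀⟩) ∈ Ω := by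
      rcases eq_or_lt_of_le h0 with h | h
      · rw [← h, zero_smul, add_zero, ← hueq]; exact huΩ
      · have hθδpos : 0 < θ * δ := mul_pos h hδ
        refine hfull (mem_cell_iff.2 ⟨⟨?_, ?_⟩, ?_, ?_⟩) <;> (first | rw [hre] | rw [him]) <;> linarith
    refine ⟨hwΩ, fun hmem => ?_⟩
    rcases htri _ hmem hwΩ with ⟨him', -⟩ | h | h
    · rw [him] at him'; linarith
    · rw [mem_cell_iff] at h; push_cast at h
      have := h.1.1; rw [hre] at this; linarith
    · rw [hre] at h; linarith

/-- **Access from `v`** (the upper end): `q = z₀ + (0, δ/16)` is joined to `δv` inside `Ω \ L`.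
[folklore] -/
theorem access_v_localV (hδ : 0 < δ) (hX : X₁ = δ * (k₁ + 1)) (hY : Y₀ = δ * y')
    (hfull : cell δ k₁ y' ⊆ Ω) {u v : Site 2} (hueq : meshPoint δ u = ⟨X₁, Y₀⟩)
    (hveq : meshPoint δ v = ⟨X₁, Y₀ + δ⟩) (hvΩ : meshPoint δ v ∈ Ω)
    (htri : ∀ z ∈ L, z ∈ Ω → (z.im = Y₀ + δ / 2 ∧ z.re ≤ X₁) ∨ z ∈ cell δ (k₁ + 1) y' ∨ z.re ≤ X₁ - δ * (3 / 2)) :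
    ∃ q ∈ ball (⟨X₁ - δ / 4, Y₀ + δ / 2⟩ : ℂ) (δ / 8),
      0 < inner (ℝ) (q - ⟨X₁ - δ / 4, Y₀ + δ / 2⟩) (meshPoint δ v - meshPoint δ u) ∧
      segment ℝ (meshPoint δ v) q ⊆ Ω \ L := by
  have hvu : meshPoint δ v - meshPoint δ u = ⟨0, δ⟩ := by rw [hueq, hveq]; apply Complex.ext <;> simp
  refine ⟨⟨X₁ - δ / 4, Y₀ + δ / 2 + δ / 16⟩, ?_, ?_, ?_⟩
  · rw [mem_ball, Complex.dist_eq]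
    rw [show (⟨X₁ - δ / 4, Y₀ + δ / 2 + δ / 16⟩ : ℂ) - ⟨X₁ - δ / 4, Y₀ + δ / 2⟩ = ((δ / 16 : ℝ)) * I by
      apply Complex.ext <;> simp]
    rw [norm_mul, Complex.norm_I, mul_one, Complex.norm_real, Real.norm_eq_abs, abs_of_pos (by positivity)]
    linarith
  · rw [hvu, inner_vertical, sub_im]
    simp only
    nlinarith [sq_pos_of_pos hδ]
  · intro z hz
    rw [segment_eq_image'] at hz
    obtain ⟨θ, ⟨h0, h1⟩, rfl⟩ := hz
    rw [hveq]
    have hre : ((⟨X₁, Y₀ + δ⟩ : ℂ) + θ • ((⟨X₁ - δ / 4, Y₀ + δ / 2 + δ / 16⟩ : ℂ) - ⟨X₁, Y₀ + δ⟩)).re =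
        X₁ - θ * (δ / 4) := by rw [re_param]; simp only; ring
    have him : ((⟨X₁, Y₀ + δ⟩ : ℂ) + θ • ((⟨X₁ - δ / 4, Y₀ + δ / 2 + δ / 16⟩ : ℂ) - ⟨X₁, Y₀ + δ⟩)).im =
        Y₀ + δ - θ * (δ * (7 / 16)) := by rw [im_param]; simp only; ring
    have hθδ0 : 0 ≤ θ * δ := mul_nonneg h0 hδ.le
    have hθδ1 : θ * δ ≤ δ := mul_le_of_le_one_left hδ.le h1
    have hwΩ : (⟨X₁, Y₀ + δ⟩ : ℂ) + θ • ((⟨X₁ - δ / 4, Y₀ + δ / 2 + δ / 16⟩ : ℂ) - ⟨X₁, Y₀ + δ⟩) ∈ Ω := by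
      rcases eq_or_lt_of_le h0 with h | h
      · rw [← h, zero_smul, add_zero, ← hveq]; exact hvΩ
      · have hθδpos : 0 < θ * δ := mul_pos h hδ
        refine hfull (mem_cell_iff.2 ⟨⟨?_, ?_⟩, ?_, ?_⟩) <;> (first | rw [hre] | rw [him]) <;> linarith
    refine ⟨hwΩ, fun hmem => ?_⟩
    rcases htri _ hmem hwΩ with ⟨him', -⟩ | h | h
    · rw [him] at him'; linarith
    · rw [mem_cell_iff] at h; push_cast at h
      have := h.1.1; rw [hre] at this; linarith
    · rw [hre] at h; linarith

/-- **The far-pole frame box beyond `v`** (above) is free of points of `L ∩ Ω`. [folklore] -/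
theorem box_v_localV (hδ : 0 < δ) (hY : Y₀ = δ * y') {v : Site 2}
    (hveq : meshPoint δ v = ⟨X₁, Y₀ + δ⟩)
    (htri : ∀ z ∈ L, z ∈ Ω → (z.im = Y₀ + δ / 2 ∧ z.re ≤ X₁) ∨ z ∈ cell δ (k₁ + 1) y' ∨ z.re ≤ X₁ - δ * (3 / 2)) :
    ∀ z ∈ L, z ∈ Ω → ∀ α β : ℝ, 0 ≤ α → α ≤ 2 → -1 ≤ β → β ≤ 1 →
      z ≠ meshPoint δ v + α • meshPoint δ (cornerUnit 1) + β • meshPoint δ (cornerUnit (1 + 1)) := by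
  obtain ⟨-, e1, e2, -⟩ := meshPoint_cornerUnit δ
  intro z hz hzΩ α β h0 h2 hb1 hb2 heq
  have hre := congrArg Complex.re heq
  have him := congrArg Complex.im heq
  rw [show (1 : Fin 4) + 1 = 2 by decide, hveq, e1, e2] at hre him
  simp only [add_re, Complex.real_smul, mul_re, ofReal_re, ofReal_im, zero_mul, sub_zero, mul_zero] at hre
  simp only [add_im, Complex.real_smul, mul_im, ofReal_re, ofReal_im, zero_mul, add_zero, mul_zero] at him
  have hαδ : 0 ≤ α * δ := mul_nonneg h0 hδ.le
  have hβδ : β * δ ≤ δ := by nlinarith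
  rcases htri z hz hzΩ with ⟨him', -⟩ | h | h
  · rw [him'] at him; linarith
  · rw [mem_cell_iff] at h; push_cast at h
    have := h.2.2; rw [him] at this; linarith
  · rw [hre] at h; linarith

/-- **The far-pole frame box beyond `u`** (below) is free of points of `L ∩ Ω`. [folklore] -/
theorem box_u_localV (hδ : 0 < δ) (hY : Y₀ = δ * y') {u : Site 2}
    (hueq : meshPoint δ u = ⟨X₁, Y₀⟩)
    (htri : ∀ z ∈ L, z ∈ Ω → (z.im = Y₀ + δ / 2 ∧ z.re ≤ X₁) ∨ z ∈ cell δ (k₁ + 1) y' ∨ z.re ≤ X₁ - δ * (3 / 2)) :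
    ∀ z ∈ L, z ∈ Ω → ∀ α β : ℝ, 0 ≤ α → α ≤ 2 → -1 ≤ β → β ≤ 1 →
      z ≠ meshPoint δ u + α • meshPoint δ (cornerUnit (1 + 2)) + β • meshPoint δ (cornerUnit (1 + 2 + 1)) := by
  obtain ⟨e0, -, -, e3⟩ := meshPoint_cornerUnit δ
  intro z hz hzΩ α β h0 h2 hb1 hb2 heq
  have hre := congrArg Complex.re heq
  have him := congrArg Complex.im heq
  rw [show (1 : Fin 4) + 2 = 3 by decide, show (3 : Fin 4) + 1 = 0 by decide, hueq, e3, e0] at hre him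
  simp only [add_re, Complex.real_smul, mul_re, ofReal_re, ofReal_im, zero_mul, sub_zero, mul_zero] at hre
  simp only [add_im, Complex.real_smul, mul_im, ofReal_re, ofReal_im, zero_mul, add_zero, mul_zero] at him
  have hαδ : 0 ≤ α * δ := mul_nonneg h0 hδ.le
  have hβδ : -δ ≤ β * δ := by nlinarith
  rcases htri z hz hzΩ with ⟨him', -⟩ | h | h
  · rw [him'] at him; linarith
  · rw [mem_cell_iff] at h; push_cast at h
    have := h.2.1; rw [him] at this; linarith
  · rw [hre] at h; linarith

end LocalV

end Summit.CriticalPhenomena.CardyFormulaZ2.Theorems.DiscretisationFamilyExists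

end
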